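import Literature.AnabelianGeometry.EtaleTheta.SettingModelChiLevelKernels
import Literature.AnabelianGeometry.EtaleTheta.SettingModelSemidirectClosure
import Literature.AnabelianGeometry.EtaleTheta.SettingModelKrullOpenSubgroups
import Literature.AnabelianGeometry.EtaleTheta.ThetaQuotientsOfCurve
import HarnessLib

/-!
# The χ-twisted root model of [EtTh] §1 (R78 (B)), file F5b: `ThetaSetting.modelχ p`, its guard, and `hYcl`

Mochizuki, *The étale theta function …*, Publ. RIMS **45** (2009) [EtTh], §1, PRIMS PDF pp. 11–14
[cite: MochizukiEtTh2009, §1 p.12]: "`Π^tp_Y`", "`(Π^tp_X)^Θ`", "`Y_N`", "`Z_N`". Layer L2 of the abc-iut cell, seat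
abc-iut-L2-t1 (root owner); abc-iut R78 reshape (B), file map R100, file F5b = the LAST assembly step: the root record
`ThetaSetting` over abc-iut-w5-d249's `curveχ p` (F4: `Π^tp_X := Γ ⋊_χ G_{ℚ_p}`, `Γ = F̂₂ ×_Ẑ ℤ`, `G_{ℚ_p}` Krull,
acting through the cyclotomic character; `Π_X := F̂₂ ⋊_χ G_{ℚ_p}`), with the theta quotients of abc-iut-L2-d1's
`CurveTheta` package, `Π^tp_X ↠ Z := pr₂ ∘ left` and the coverings `Π^tp_{Y_N} = Δ^tp_{Y_N} ⋊ G_{K_N}`,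
`Π^tp_{Z_N} = Δ^tp_{Z_N} ⋊ G_{J_N}` of F5a (`SettingModelChiCoverings`), the Krull-openness of `G_{K_N}`, `G_{J_N}`
(abc-iut-L2-t11's `SettingModelKrullOpenSubgroups`), and the clause `Ker(Π^tp_X ↠ (Π^tp_X)^Θ) ∩ Π^tp_{Y_N} ≤ Π^tp_{Z_N}`
(the level maps kill `[[Δ̂,Δ̂],Δ̂]⁻ = inl(γ₃(F̂₂)⁻)`, `SettingModelSemidirectClosure`; the `Normal` instances of the
kernels at `curveχ` come from abc-iut-L6-d6's `SettingModelChiLevelKernels`). RESULTS: `ThetaSetting.modelχ p`,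
`modelχ_isEtThOrigin` (Δ_X = inl(F̂₂) free), `coe_map_dtpY_modelχ` (image of `Δ^tp_Y` in `Π_X` = `inl(Ker ê)`),
`hYcl_modelχ`, `modelχ_isEtThOrigin_and_hYcl` — a model of the §1 root with NON-TRIVIAL Galois action on `Δ_Θ ≅ Ẑ(1)`
in which root + guard + `hYcl` hold together. SEMI-SYNTHETIC MODEL (not the tempered `π₁` of a curve); consistency
evidence only; nothing of [EtTh] asserted; no side taken on [IUTchIII] Cor. 3.12.
-/

noncomputable section

open Topology Function

namespace Literature.AnabelianGeometry.EtaleTheta.SettingModel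

open Literature.AnabelianGeometry.SemiGraphs

variable (p : ℕ) [Fact p.Prime]

/-- `Δ_X ≤ inl(F̂₂)` in `Π_X = F̂₂ ⋊_χ G_{ℚ_p}`. [cite: MochizukiEtTh2009, §1 p.12] -/
theorem deltaHatχ_le_range_inl :
    (curveχ p).DeltaHat ≤ (SemidirectProduct.inl : F₂hatT →* PiHtχ p).range := by
  rw [deltaHatχ_eq, ← SemidirectProduct.range_inl_eq_ker_rightHom]

/-- **The level maps kill `Ker(Π^tp_X ↠ (Π^tp_X)^Θ)`** at the χ-model: for `g` in the theta kernel and every `N`,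
`ĥ_N(pr₁ g.left) = 1`. [cite: MochizukiEtTh2009, §1 p.14] -/
theorem levelHom_eq_one_of_mem_thetaKerχ {g : PiTpχ p} (hg : g ∈ CurveTheta.thetaKer (curveχ p)) (N : ℕ+) :
    levelHom N g.left = 1 := by
  have hmem : toHatχ p g ∈
      (⁅⁅(curveχ p).DeltaHat, (curveχ p).DeltaHat⁆, (curveχ p).DeltaHat⁆).topologicalClosure := hg
  have h := hHat_left_eq_one_of_mem_closure_commutator₃_of_le (isInducing_leftRightHatχ p)
    (deltaHatχ_le_range_inl p) hmem N
  show hHat N (gfpFst g.left) = 1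
  rw [← toHatχ_left p g]
  exact h.1

/-- **`Ker(Π^tp_X ↠ (Π^tp_X)^Θ) ∩ Π^tp_{Y_N} ≤ Π^tp_{Z_N}`** in the χ-model. [cite: MochizukiEtTh2009, §1 p.14] -/
theorem thetaKer_inf_YNχ_le_ZNχ (N : ℕ+) : CurveTheta.thetaKer (curveχ p) ⊓ YNχ p N ≤ ZNχ p N := by
  intro g hg
  obtain ⟨hT, hY⟩ := Subgroup.mem_inf.mp hg
  have hright : g.right = 1 := (mem_deltaTempχ_iff p g).mp (CurveTheta.thetaKer_le_deltaTemp (curveχ p) hT)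
  exact (chiTwistData p).mem_ZN_of_levelHom_eq_one hY (levelHom_eq_one_of_mem_thetaKerχ p hT N)
    (by rw [hright]; exact Subgroup.one_mem _)

/-- **The χ-twisted model of the [EtTh] §1 root** (`Π^tp_X := (F̂₂ ×_Ẑ ℤ) ⋊_χ G_{ℚ_p}`, `K := ℚ_p`, `q_X := p²`,
`Y_N`/`Z_N` from the profinite level maps twisted by `G_{K_N}`/`G_{J_N}`). SEMI-SYNTHETIC (not the tempered `π₁`
of a curve). [cite: MochizukiEtTh2009, §1 p.11] -/
abbrev _root_.Literature.AnabelianGeometry.EtaleTheta.ThetaSetting.modelχ : ThetaSetting p where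
  toTemperedCurve := curveχ p
  qX := qModel p
  qX_mem := qModel_mem_botχ p
  norm_qX_lt_one := (ThetaSetting.model p).norm_qX_lt_one
  qX_ne_zero := qModel_ne_zeroχ p
  sqrtqX := ((p : ℕ) : PadicAlgCl p)
  sqrtqX_sq := rfl
  toZ := (chiTwistData p).toZ
  toZ_surjective := (chiTwistData p).toZ_surjective
  isOpen_ker_toZ := (chiTwistData p).isOpen_ker_toZ (continuous_leftRight p)
  toZ_delta_surjective := (chiTwistData p).toZ_restrict_surjective
  GtpTheta := CurveTheta.GTheta (curveχ p)
  toTheta := CurveTheta.toTheta (curveχ p)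
  continuous_toTheta := CurveTheta.continuous_toTheta (curveχ p)
  toTheta_surjective := CurveTheta.toTheta_surjective (curveχ p)
  ker_toTheta := CurveTheta.ker_toTheta (curveχ p)
  GtpEll := CurveTheta.GEll (curveχ p)
  thetaToEll := CurveTheta.thetaToEll (curveχ p)
  continuous_thetaToEll := CurveTheta.continuous_thetaToEll (curveχ p)
  thetaToEll_surjective := CurveTheta.thetaToEll_surjective (curveχ p)
  ker_toEll := CurveTheta.ker_toEll (curveχ p)
  ker_thetaToEll_comm := CurveTheta.ker_thetaToEll_comm (curveχ p)
  ker_thetaToEll_central := CurveTheta.ker_thetaToEll_central (curveχ p)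
  GtpYN := YNχ p
  GtpYN_one := YNχ_one p
  GtpYN_le := YNχ_le p
  map_aug_GtpYN N := map_rightHom_YNχ p N
  GtpYN_normal := YNχ_normal p
  isOpen_GtpYN N := isOpen_YNχ p (continuous_leftRight p) N (isOpen_fixingSubgroup_fieldKN ⊥ (qModel p) N)
  GtpYN_anti M N h := YNχ_anti p h
  relIndex_deltaYN N := relIndex_YNχ p N
  GtpZN := ZNχ p
  GtpZN_le := ZNχ_le_YNχ p
  map_aug_GtpZN N := map_rightHom_ZNχ p N
  GtpZN_normal := ZNχ_normal p
  isOpen_GtpZN N := isOpen_ZNχ p (continuous_leftRight p) N (isOpen_fixingSubgroup_fieldJN ⊥ (qModel p) N)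
  GtpZN_anti M N h := ZNχ_anti p h
  relIndex_deltaZN N := relIndex_ZNχ p N
  ker_toTheta_le_GtpZN N := by
    rw [CurveTheta.ker_toTheta]
    exact thetaKer_inf_YNχ_le_ZNχ p N

/-- **The χ-model satisfies the guard `IsEtThOrigin`** (`Δ_X = inl(F̂₂)` is profinite free on two generators).
[cite: MochizukiEtTh2009, §1 p.12] -/
theorem _root_.Literature.AnabelianGeometry.EtaleTheta.ThetaSetting.modelχ_isEtThOrigin :
    (ThetaSetting.modelχ p).IsEtThOrigin :=
  ThetaSetting.IsEtThOrigin.of_free (isFreeProfiniteOnTwo_deltaHatχ p)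

/-- **The image of `Δ^tp_Y` in `Π_X` is `inl(Ker ê)`** (χ-model). [cite: MochizukiEtTh2009, §1 p.12] -/
theorem coe_map_dtpY_modelχ : ((ThetaSetting.modelχ p).DtpY.map (ThetaSetting.modelχ p).toHat.toMonoidHom :
    Set (PiHtχ p)) = (SemidirectProduct.inl : F₂hatT → PiHtχ p) '' (eHat ⁻¹' {1}) := by
  ext y
  constructor
  · rintro ⟨g, hg, rfl⟩
    obtain ⟨hg1, hg2⟩ := Subgroup.mem_inf.mp hg
    have hsnd : gfpSnd g.left = 1 := hg1
    have hright : g.right = 1 := (mem_deltaTempχ_iff p g).mp hg2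
    refine ⟨gfpFst g.left, ?_, ?_⟩
    · show eHat (gfpFst g.left) = 1
      rw [gfpFst_apply, (mem_Gfp _).mp g.left.2, ← gfpSnd_apply, hsnd, map_one]
    · apply SemidirectProduct.ext
      · rw [SemidirectProduct.left_inl]
        exact (toHatχ_left p g).symm
      · rw [SemidirectProduct.right_inl]
        exact ((toHatχ_right p g).trans hright).symm
  · rintro ⟨x, hx, rfl⟩
    have hx' : eHat x = 1 := hx
    let γ : Gfp := ⟨(x, 1), by rw [mem_Gfp, hx', map_one]⟩
    refine ⟨SemidirectProduct.inl γ, Subgroup.mem_inf.mpr ⟨?_, ?_⟩, ?_⟩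
    · show gfpSnd (SemidirectProduct.inl γ : PiTpχ p).left = 1
      rw [SemidirectProduct.left_inl, gfpSnd_apply]
    · exact (mem_deltaTempχ_iff p _).mpr (SemidirectProduct.right_inl γ)
    · apply SemidirectProduct.ext
      · show (toHatχ p (SemidirectProduct.inl γ)).left = x
        rw [toHatχ_left, SemidirectProduct.left_inl, gfpFst_apply]
      · show (toHatχ p (SemidirectProduct.inl γ)).right = 1
        rw [toHatχ_right, SemidirectProduct.right_inl]

/-- **`hYcl` HOLDS in the χ-model**: the image of `Δ^tp_Y` in `Π_X` is closed (so its closure is itself, a fortiori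
inside image `⊔ [[Δ_X,Δ_X],Δ_X]⁻`). [cite: MochizukiEtTh2009, §1 p.12] -/
theorem hYcl_modelχ :
    ((ThetaSetting.modelχ p).DtpY.map (ThetaSetting.modelχ p).toHat.toMonoidHom).topologicalClosure ≤
      (ThetaSetting.modelχ p).DtpY.map (ThetaSetting.modelχ p).toHat.toMonoidHom ⊔
        (⁅⁅(ThetaSetting.modelχ p).DeltaHat, (ThetaSetting.modelχ p).DeltaHat⁆,
          (ThetaSetting.modelχ p).DeltaHat⁆).topologicalClosure := by
  refine (Subgroup.topologicalClosure_minimal _ le_rfl ?_).trans le_sup_left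
  show IsClosed (((ThetaSetting.modelχ p).DtpY.map (ThetaSetting.modelχ p).toHat.toMonoidHom : Subgroup (PiHtχ p)) :
    Set (PiHtχ p))
  rw [coe_map_dtpY_modelχ]
  exact isClosed_image_inl (isInducing_leftRightHatχ p) (isClosed_singleton.preimage eHat.continuous)

/-- **Root + guard + `hYcl` hold together at the χ-model** (non-trivial Galois action on `Δ_Θ`).
[cite: MochizukiEtTh2009, §1 p.12] -/
theorem _root_.Literature.AnabelianGeometry.EtaleTheta.ThetaSetting.modelχ_isEtThOrigin_and_hYcl :
    (ThetaSetting.modelχ p).IsEtThOrigin ∧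
      ((ThetaSetting.modelχ p).DtpY.map (ThetaSetting.modelχ p).toHat.toMonoidHom).topologicalClosure ≤
        (ThetaSetting.modelχ p).DtpY.map (ThetaSetting.modelχ p).toHat.toMonoidHom ⊔
          (⁅⁅(ThetaSetting.modelχ p).DeltaHat, (ThetaSetting.modelχ p).DeltaHat⁆,
            (ThetaSetting.modelχ p).DeltaHat⁆).topologicalClosure :=
  ⟨ThetaSetting.modelχ_isEtThOrigin p, hYcl_modelχ p⟩

/-- **`aug` is an OPEN map at the χ-model** (the clause that FAILS at the discrete-Galois models `model`/`model₂`,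
abc-iut-L2-t11's `SettingModelAugNotOpen`). [cite: MochizukiEtTh2009, §1 p.12] -/
theorem isOpenMap_aug_modelχ : IsOpenMap (ThetaSetting.modelχ p).aug := isOpenMap_augχ p

end Literature.AnabelianGeometry.EtaleTheta.SettingModel

end
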